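import Mathlib
import Literature.NumberTheory.Transcendental.GammaFields
import Summits.Schanuel.Schanuel.Theorems.RigidCoreAclSubsetLogFreeCoreCaseIILaurent

/-!
# Case II core, file 6b: the field `K = k(exp Y'')` — fractions in lowest terms
(registered stub `stub_caseII_fractions` of line `eac-extends-core-automorphisms`,
crux stmt-Schanuel-0968 `Summit.Schanuel.Schanuel.Theses.RigidCore.AclSubsetLogFreeCore`)

Same setting as files 4 and 6a (`…CaseIIMonomials`, `…CaseIILaurent`): a subfield `k ≤ E` of an
exponential field, `ℚ`-subspaces `Y' ≤ Y''` with `exp Y' ⊆ k`, a tuple `b` spanning `Y''` modulo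
`Y'`; for `N ≥ 1` the level-`N` coordinates are `t i = exp ((1/N) • b i)` and
`ev_N = MvPolynomial.aeval t`.

* `exists_fraction` — every element of the subfield `K` generated by `k` and `exp Y''` is a quotient
  `ev_N P / ev_N Q` (`ev_N Q ≠ 0`) for some level `N` (closure induction, using the Laurent
  presentation of `exp y`, `y ∈ Y''`, from file 6a and the change of level `aeval_expand`).
* `fraction_reduce` — any such quotient can be brought to lowest terms (`MvPolynomial σ K` over a
  field is a unique factorisation domain: divide numerator and denominator by their `gcd`).
* `stub_caseII_fractions` — the registered statement: both combined.
-/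

noncomputable section

set_option linter.dupNamespace false

open Set
open scoped BigOperators
open Literature.ModelTheory.ExponentialFields Literature.ModelTheory.ExponentialFields.ExponentialRing
open Literature.NumberTheory.Transcendental Literature.NumberTheory.Transcendental.GammaField

namespace Summit.Schanuel.Schanuel.Theorems.RigidCore

namespace CaseIICore

variable {E : Type*} [Field E] [CharZero E] [ExponentialRing E]

/-! ### Unreduced fractions: closure properties -/

/-- Sum of two fractions at the same level:
`(z₁ + z₂) * ev (Q₁ Q₂) = ev (P₁ Q₂ + P₂ Q₁)`. [folklore] -/
theorem fraction_add_same (k : Subfield E) {p : ℕ} (b : Fin p → E) (N : ℕ)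
    {z₁ z₂ : E} {P₁ Q₁ P₂ Q₂ : MvPolynomial (Fin p) k}
    (h₁ : z₁ * MvPolynomial.aeval (fun i => exp ((1 / (N : ℚ)) • b i)) Q₁ =
      MvPolynomial.aeval (fun i => exp ((1 / (N : ℚ)) • b i)) P₁)
    (h₂ : z₂ * MvPolynomial.aeval (fun i => exp ((1 / (N : ℚ)) • b i)) Q₂ =
      MvPolynomial.aeval (fun i => exp ((1 / (N : ℚ)) • b i)) P₂) :
    (z₁ + z₂) * MvPolynomial.aeval (fun i => exp ((1 / (N : ℚ)) • b i)) (Q₁ * Q₂) =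
      MvPolynomial.aeval (fun i => exp ((1 / (N : ℚ)) • b i)) (P₁ * Q₂ + P₂ * Q₁) := by
  rw [map_add, map_mul, map_mul, map_mul, ← h₁, ← h₂]
  ring

/-- Product of two fractions at the same level: `(z₁ z₂) * ev (Q₁ Q₂) = ev (P₁ P₂)`. [folklore] -/
theorem fraction_mul_same (k : Subfield E) {p : ℕ} (b : Fin p → E) (N : ℕ)
    {z₁ z₂ : E} {P₁ Q₁ P₂ Q₂ : MvPolynomial (Fin p) k}
    (h₁ : z₁ * MvPolynomial.aeval (fun i => exp ((1 / (N : ℚ)) • b i)) Q₁ =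
      MvPolynomial.aeval (fun i => exp ((1 / (N : ℚ)) • b i)) P₁)
    (h₂ : z₂ * MvPolynomial.aeval (fun i => exp ((1 / (N : ℚ)) • b i)) Q₂ =
      MvPolynomial.aeval (fun i => exp ((1 / (N : ℚ)) • b i)) P₂) :
    (z₁ * z₂) * MvPolynomial.aeval (fun i => exp ((1 / (N : ℚ)) • b i)) (Q₁ * Q₂) =
      MvPolynomial.aeval (fun i => exp ((1 / (N : ℚ)) • b i)) (P₁ * P₂) := by
  rw [map_mul, map_mul, ← h₁, ← h₂]
  ring

/-- A non-vanishing denominator `ev_N Q ≠ 0` persists at level `N e` with `expand e`. [folklore] -/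
theorem aeval_expand_ne_zero (k : Subfield E) {p : ℕ} (b : Fin p → E) {N : ℕ} (hN : 0 < N) {e : ℕ}
    (he : 0 < e) {Q : MvPolynomial (Fin p) k}
    (hQ : MvPolynomial.aeval (fun i => exp ((1 / (N : ℚ)) • b i)) Q ≠ 0) :
    MvPolynomial.aeval (fun i => exp ((1 / ((N * e : ℕ) : ℚ)) • b i)) (MvPolynomial.expand e Q) ≠ 0 := by
  rwa [aeval_expand k b hN he]

/-- **Every element of `K = k(exp Y'')` is a fraction** `ev_N P / ev_N Q` with `ev_N Q ≠ 0`, for some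
level `N ≥ 1` (not necessarily in lowest terms). [folklore] -/
theorem exists_fraction (k : Subfield E) {Y' Y'' : Submodule ℚ E} {p : ℕ} (b : Fin p → E)
    (hbspan : ∀ y ∈ Y'', ∃ r : Fin p → ℚ, y - ∑ i, r i • b i ∈ Y')
    (hexpY' : ∀ y ∈ Y', exp y ∈ k) {z : E}
    (hz : z ∈ Subfield.closure ((k : Set E) ∪ exp '' (Y'' : Set E))) :
    ∃ N : ℕ, 0 < N ∧ ∃ (P Q : MvPolynomial (Fin p) k),
      MvPolynomial.aeval (fun i => exp ((1 / (N : ℚ)) • b i)) Q ≠ 0 ∧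
      z * MvPolynomial.aeval (fun i => exp ((1 / (N : ℚ)) • b i)) Q =
        MvPolynomial.aeval (fun i => exp ((1 / (N : ℚ)) • b i)) P := by
  induction hz using Subfield.closure_induction with
  | mem x hx =>
    rcases hx with hx | ⟨y, hy, rfl⟩
    · exact ⟨1, one_pos, MvPolynomial.C ⟨x, hx⟩, 1, by rw [map_one]; exact one_ne_zero,
        by rw [map_one, mul_one, MvPolynomial.aeval_C]; rfl⟩
    · obtain ⟨N, hN, Mp, Mm, c, -, h⟩ := exists_laurent_exp k b hbspan hexpY' hy
      exact ⟨N, hN, _, _, aeval_monomial_one_ne_zero k b N Mm, h⟩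
  | one => exact ⟨1, one_pos, 1, 1, by rw [map_one]; exact one_ne_zero, by rw [map_one, mul_one]⟩
  | add x y _ _ hx hy =>
    obtain ⟨N₁, hN₁, P₁, Q₁, hQ₁, h₁⟩ := hx
    obtain ⟨N₂, hN₂, P₂, Q₂, hQ₂, h₂⟩ := hy
    have h₁' := fraction_level k b hN₁ hN₂ h₁
    have h₂' := fraction_level k b hN₂ hN₁ h₂
    have hQ₁' := aeval_expand_ne_zero k b hN₁ hN₂ hQ₁
    have hQ₂' := aeval_expand_ne_zero k b hN₂ hN₁ hQ₂
    rw [Nat.mul_comm N₂ N₁] at h₂' hQ₂'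
    exact ⟨N₁ * N₂, Nat.mul_pos hN₁ hN₂, _, _, by rw [map_mul]; exact mul_ne_zero hQ₁' hQ₂',
      fraction_add_same k b (N₁ * N₂) h₁' h₂'⟩
  | neg x _ hx =>
    obtain ⟨N, hN, P, Q, hQ, h⟩ := hx
    exact ⟨N, hN, -P, Q, hQ, by rw [map_neg, neg_mul, h]⟩
  | inv x _ hx =>
    obtain ⟨N, hN, P, Q, hQ, h⟩ := hx
    by_cases hx0 : x = 0
    · exact ⟨N, hN, 0, 1, by rw [map_one]; exact one_ne_zero,
        by rw [hx0, inv_zero, zero_mul, map_zero]⟩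
    · have hP : MvPolynomial.aeval (fun i => exp ((1 / (N : ℚ)) • b i)) P ≠ 0 := by
        rw [← h]; exact mul_ne_zero hx0 hQ
      exact ⟨N, hN, Q, P, hP, by rw [← h, ← mul_assoc, inv_mul_cancel₀ hx0, one_mul]⟩
  | mul x y _ _ hx hy =>
    obtain ⟨N₁, hN₁, P₁, Q₁, hQ₁, h₁⟩ := hx
    obtain ⟨N₂, hN₂, P₂, Q₂, hQ₂, h₂⟩ := hy
    have h₁' := fraction_level k b hN₁ hN₂ h₁
    have h₂' := fraction_level k b hN₂ hN₁ h₂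
    have hQ₁' := aeval_expand_ne_zero k b hN₁ hN₂ hQ₁
    have hQ₂' := aeval_expand_ne_zero k b hN₂ hN₁ hQ₂
    rw [Nat.mul_comm N₂ N₁] at h₂' hQ₂'
    exact ⟨N₁ * N₂, Nat.mul_pos hN₁ hN₂, _, _, by rw [map_mul]; exact mul_ne_zero hQ₁' hQ₂',
      fraction_mul_same k b (N₁ * N₂) h₁' h₂'⟩

/-! ### Lowest terms -/

/-- **Reduction to lowest terms.** A quotient `z = φ P / φ Q` (`φ Q ≠ 0`) of values of the
evaluation `φ = MvPolynomial.aeval t` into a field can be rewritten with `P, Q` relatively prime: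
divide `P` and `Q` by `gcd P Q` in the unique factorisation domain `MvPolynomial σ K`
(`extract_gcd`). [folklore] -/
theorem fraction_reduce {K A : Type*} [Field K] [Field A] [Algebra K A] {σ : Type*} (t : σ → A)
    {z : A} {P Q : MvPolynomial σ K} (hQ : MvPolynomial.aeval t Q ≠ 0)
    (h : z * MvPolynomial.aeval t Q = MvPolynomial.aeval t P) :
    ∃ P' Q' : MvPolynomial σ K, IsRelPrime P' Q' ∧ MvPolynomial.aeval t Q' ≠ 0 ∧
      z * MvPolynomial.aeval t Q' = MvPolynomial.aeval t P' := by
  letI := UniqueFactorizationMonoid.toGCDMonoid (MvPolynomial σ K)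
  obtain ⟨P', Q', hP, hQ', hunit⟩ := extract_gcd P Q
  set g := gcd P Q
  rw [hQ', map_mul] at hQ h
  rw [hP, map_mul, mul_left_comm] at h
  exact ⟨P', Q', gcd_isUnit_iff_isRelPrime.mp hunit, right_ne_zero_of_mul hQ,
    mul_left_cancel₀ (left_ne_zero_of_mul hQ) h⟩

end CaseIICore

/-! ### The registered stub -/

/-- **Fractions in lowest terms for the field `K = k(exp Y'')`** (one level of the canonical tower,
abstracted as in `…CaseIIMonomials`/`…CaseIILaurent`): every element `z` of the subfield generated by
`k` and `exp Y''` is a quotient `P(t)/Q(t)` of polynomials over `k` in the level-`N` coordinates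
`tᵢ = exp (bᵢ / N)` (some `N ≥ 1`) with `P, Q` relatively prime and `Q(t) ≠ 0`.
Proof: closure induction gives some fraction (`CaseIICore.exists_fraction`), and
`MvPolynomial (Fin p) k` is a unique factorisation domain, so one may divide `P, Q` by their `gcd`
(`CaseIICore.fraction_reduce`). [folklore] -/
theorem stub_caseII_fractions {E : Type*} [Field E] [CharZero E] [ExponentialRing E]
    (k : Subfield E) {Y' Y'' : Submodule ℚ E} {p : ℕ} (b : Fin p → E)
    (hbspan : ∀ y ∈ Y'', ∃ r : Fin p → ℚ, y - ∑ i, r i • b i ∈ Y')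
    (hexpY' : ∀ y ∈ Y', exp y ∈ k) {z : E}
    (hz : z ∈ Subfield.closure ((k : Set E) ∪ exp '' (Y'' : Set E))) :
    ∃ N : ℕ, 0 < N ∧ ∃ (P Q : MvPolynomial (Fin p) k), IsRelPrime P Q ∧
      MvPolynomial.aeval (fun i => exp ((1 / (N : ℚ)) • b i)) Q ≠ 0 ∧
      z * MvPolynomial.aeval (fun i => exp ((1 / (N : ℚ)) • b i)) Q =
        MvPolynomial.aeval (fun i => exp ((1 / (N : ℚ)) • b i)) P := by
  obtain ⟨N, hN, P, Q, hQ, h⟩ := CaseIICore.exists_fraction k b hbspan hexpY' hz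
  exact ⟨N, hN, CaseIICore.fraction_reduce _ hQ h⟩

end Summit.Schanuel.Schanuel.Theorems.RigidCore
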